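import Literature.Analysis.FluidPDE.PeriodicCylinderWallTrace
import HarnessLib

/-!
# The `L⁴` Gagliardo–Nirenberg inequality on the period cell of the cylinder

Topic `Literature/Analysis/FluidPDE`. The interpolation inequality behind the commutator
estimate of Ferrari's Lemma 1 (A. B. Ferrari, Comm. Math. Phys. **155** (1993), Lemma 1 (ii),
p. 280: `|D^α(fg) - f D^α g|_{L²} ≤ C (|f|_{H^s} |g|_{L^∞} + |f|_{W^{1,∞}} |g|_{H^{s-1}})`, "easily
derived using extension operators ... together with the free space versions of the estimates"
of Klainerman–Majda and Moser) at `s = 3`, where the only product not directly of the form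
`L^∞ × L²` is `|D²u|²`, controlled by the **Nirenberg `L⁴` inequality**
`‖Dh‖²_{L⁴} ≤ C ‖h‖_{L^∞} ‖h‖_{H²}` (L. Nirenberg, Ann. Sc. Norm. Sup. Pisa 13 (1959), the case
`j = 1`, `m = 2`, `p = ∞`, `r = 2`, `q = 4` of the general inequality; on bounded domains with
lower-order term). On the period cell `{r < 1} × (0, L)` of the periodic cylinder we **prove**
(`exists_integral_norm_fderiv_pow_four_le`): there is an absolute constant `C` such that for
every `L > 0`, every `g` of class `C²` on the closed cylinder `{r ≤ 1}`, `L`-periodic in `z`,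
with `‖g‖ ≤ M` there, and every direction `‖v‖ ≤ 1`,

  `∫_cell ‖∂ᵥ g‖⁴ ≤ C M² ∫_cell (‖∂ᵥ g‖² + ‖D ∂ᵥ g‖²)`.

## Proof (integration by parts with the wall term)

With `w = ∂ᵥ g`, `W = ‖w‖² w` and `φ = ⟪g, W⟫`: pointwise `‖w‖⁴ = ∂ᵥφ - ⟪g, ∂ᵥ W⟫` and
`‖DW‖ ≤ 3 ‖w‖² ‖Dw‖`. Integrating over the cell, `∫ ∂ᵥφ` is a wall integral
(`setIntegral_fderiv_apply_cylinderCell_eq_wallFlux`: the periodic ends cancel) bounded by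
`M ∫_wall ‖W‖ ≤ M C_tr ∫_cell (‖W‖ + ‖DW‖)` by the trace inequality on the wall
(`exists_wallTrace_le`), and `|∫ ⟪g, ∂ᵥW⟫| ≤ 3M ∫ ‖w‖²‖Dw‖`; hence
`X² := ∫‖w‖⁴ ≤ M C' ∫ (‖w‖³ + ‖w‖² ‖Dw‖) ≤ M C' X (‖w‖_{L²} + ‖Dw‖_{L²})` by Cauchy–Schwarz, and
`X ≤ M C' (‖w‖_{L²} + ‖Dw‖_{L²})`. This is the standard proof of Nirenberg's inequality for
`q = 4` (one integration by parts), the boundary term being handled by the trace inequality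
instead of an extension operator. All statements are folklore calculus given the two cited
inequalities.

## Mathlib / tree search

Mathlib (this pin) has the Gagliardo–Nirenberg–Sobolev inequality `‖u‖_{p*} ≤ C ‖Du‖_p`
(`MeasureTheory.eLpNorm_le_eLpNorm_fderiv_of_eq`) but no interpolation inequalities of
Nirenberg type; tree: `lean search 'Nirenberg|interpolation inequality|L4'` — Ladyzhenskaya
inequalities on the torus (`FunctionSpaces/LadyzhenskayaTorus`, `TorusLadyzhenskaya`) and the
whole plane only, nothing on domains with boundary.

## References

* A. B. Ferrari, *On the blow-up of solutions of the 3-D Euler equations in a bounded domain*,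
  Comm. Math. Phys. 155 (1993) 277–294, Lemma 1, p. 280. [Ferrari1993]
* L. Nirenberg, *On elliptic partial differential equations*, Ann. Scuola Norm. Sup. Pisa (3) 13
  (1959) 115–162, Lecture II (the interpolation inequalities).
-/

noncomputable section

open MeasureTheory Set Function Filter Topology TopologicalSpace WithLp Real
open scoped ContDiff NNReal ENNReal InnerProductSpace RealInnerProductSpace Pointwise

namespace Literature.Analysis.FluidPDE

section Periodicity

variable {F : Type*} [NormedAddCommGroup F] [NormedSpace ℝ F]

/-- The closed cylinder is invariant under the axial translation, as a set identity for the
translate. [folklore] -/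
theorem axialShift_vadd_closure_unitCylinder (L : ℝ) :
    (L • EuclideanSpace.single (2 : Fin 3) (1 : ℝ)) +ᵥ
        closure (unitCylinder : Set (EuclideanSpace ℝ (Fin 3))) =
      closure (unitCylinder : Set (EuclideanSpace ℝ (Fin 3))) := by
  ext y
  rw [Set.mem_vadd_set_iff_neg_vadd_mem, vadd_eq_add, neg_add_eq_sub,
    show y - L • EuclideanSpace.single (2 : Fin 3) (1 : ℝ) =
      y + (-L) • EuclideanSpace.single (2 : Fin 3) (1 : ℝ) by rw [neg_smul, sub_eq_add_neg],
    add_axialShift_mem_closure_unitCylinder_iff]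

/-- **The derivative of an axially periodic field is axially periodic** (within the closed
cylinder, which is translation invariant). [folklore] -/
theorem IsAxiallyPeriodic.fderivWithin_closure {L : ℝ} {g : EuclideanSpace ℝ (Fin 3) → F}
    (hper : IsAxiallyPeriodic L g) :
    IsAxiallyPeriodic L fun x =>
      fderivWithin ℝ g (closure (unitCylinder : Set (EuclideanSpace ℝ (Fin 3)))) x := by
  intro x
  have hga : (fun y => g (y + L • EuclideanSpace.single (2 : Fin 3) (1 : ℝ))) = g := funext hper
  dsimp only
  conv_rhs => rw [← hga]
  rw [fderivWithin_comp_add_right, axialShift_vadd_closure_unitCylinder]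

end Periodicity

section GN

variable {F : Type*} [NormedAddCommGroup F] [InnerProductSpace ℝ F]

/-- The derivative of `‖w‖² w` is bounded by `3 ‖w‖² ‖Dw‖`. [folklore] -/
theorem norm_fderiv_norm_sq_smul_le {w : EuclideanSpace ℝ (Fin 3) → F} {x : EuclideanSpace ℝ (Fin 3)}
    (hw : DifferentiableAt ℝ w x) :
    ‖fderiv ℝ (fun y => ‖w y‖ ^ 2 • w y) x‖ ≤ 3 * ‖w x‖ ^ 2 * ‖fderiv ℝ w x‖ := by
  have h := hw.hasFDerivAt.norm_sq.smul hw.hasFDerivAt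
  rw [show (fun y => ‖w y‖ ^ 2 • w y) = ((‖w ·‖ ^ 2) • w) from rfl, h.fderiv]
  set T : EuclideanSpace ℝ (Fin 3) →L[ℝ] ℝ := (innerSL ℝ (w x)).comp (fderiv ℝ w x) with hT
  have e2 : (2 : ℕ) • T = (2 : ℝ) • T := by rw [two_smul, two_smul]
  have hT' : ‖T‖ ≤ ‖w x‖ * ‖fderiv ℝ w x‖ :=
    calc ‖T‖ ≤ ‖innerSL ℝ (w x)‖ * ‖fderiv ℝ w x‖ := ContinuousLinearMap.opNorm_comp_le _ _
      _ = ‖w x‖ * ‖fderiv ℝ w x‖ := by rw [innerSL_apply_norm]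
  calc ‖‖w x‖ ^ 2 • fderiv ℝ w x + ((2 : ℕ) • T).smulRight (w x)‖
      ≤ ‖‖w x‖ ^ 2 • fderiv ℝ w x‖ + ‖((2 : ℕ) • T).smulRight (w x)‖ := norm_add_le _ _
    _ = ‖w x‖ ^ 2 * ‖fderiv ℝ w x‖ + 2 * ‖T‖ * ‖w x‖ := by
        rw [norm_smul, Real.norm_of_nonneg (by positivity), e2, ContinuousLinearMap.norm_smulRight_apply,
          norm_smul, Real.norm_two]
    _ ≤ ‖w x‖ ^ 2 * ‖fderiv ℝ w x‖ + 2 * (‖w x‖ * ‖fderiv ℝ w x‖) * ‖w x‖ := by gcongr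
    _ = 3 * ‖w x‖ ^ 2 * ‖fderiv ℝ w x‖ := by ring

/-- **Cauchy–Schwarz for nonnegative continuous functions on the period cell**, in the form
`∫_cell f² h ≤ √(∫_cell f⁴) √(∫_cell h²)` for `f, h` continuous on the closed cylinder, `h ≥ 0`.
[folklore] -/
theorem setIntegral_sq_mul_le_sqrt_mul_sqrt (L : ℝ) {f h : EuclideanSpace ℝ (Fin 3) → ℝ}
    (hf : ContinuousOn f (closure (unitCylinder : Set (EuclideanSpace ℝ (Fin 3)))))
    (hh : ContinuousOn h (closure (unitCylinder : Set (EuclideanSpace ℝ (Fin 3)))))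
    (hh0 : ∀ x, 0 ≤ h x) :
    ∫ x in (cylinderCell L : Set (EuclideanSpace ℝ (Fin 3))), f x ^ 2 * h x ≤
      Real.sqrt (∫ x in (cylinderCell L : Set (EuclideanSpace ℝ (Fin 3))), f x ^ 4) *
        Real.sqrt (∫ x in (cylinderCell L : Set (EuclideanSpace ℝ (Fin 3))), h x ^ 2) := by
  have hf2 : MemLp (fun x => f x ^ 2) (ENNReal.ofReal 2)
      (volume.restrict (cylinderCell L : Set _)) := by
    rw [ENNReal.ofReal_ofNat]; exact memLp_cylinderCell_of_continuousOn_closure L 2 (hf.pow 2)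
  have hh2 : MemLp h (ENNReal.ofReal 2) (volume.restrict (cylinderCell L : Set _)) := by
    rw [ENNReal.ofReal_ofNat]; exact memLp_cylinderCell_of_continuousOn_closure L 2 hh
  have H := integral_mul_le_Lp_mul_Lq_of_nonneg Real.HolderConjugate.two_two
    (Eventually.of_forall fun x => sq_nonneg (f x)) (Eventually.of_forall hh0) hf2 hh2
  have e4 : ∫ x in (cylinderCell L : Set (EuclideanSpace ℝ (Fin 3))), (f x ^ 2) ^ (2 : ℝ) =
      ∫ x in (cylinderCell L : Set (EuclideanSpace ℝ (Fin 3))), f x ^ 4 :=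
    integral_congr_ae (Eventually.of_forall fun x => by
      simp only [Real.rpow_two]; ring)
  have e2 : ∫ x in (cylinderCell L : Set (EuclideanSpace ℝ (Fin 3))), h x ^ (2 : ℝ) =
      ∫ x in (cylinderCell L : Set (EuclideanSpace ℝ (Fin 3))), h x ^ 2 :=
    integral_congr_ae (Eventually.of_forall fun x => by simp only [Real.rpow_two])
  rw [e4, e2] at H
  rwa [Real.sqrt_eq_rpow, Real.sqrt_eq_rpow]

/-- **The `L⁴` Gagliardo–Nirenberg (Nirenberg) inequality on the period cell of the cylinder**
(Nirenberg 1959, Lecture II, the case `‖Dh‖²_{L⁴} ≤ C ‖h‖_{L^∞} ‖D²h‖_{L²}` of the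
interpolation inequalities, on a bounded domain with the lower-order term; the analytic input of
Ferrari 1993, Lemma 1 (ii), p. 280, at `s = 3`): there is an absolute constant `C` such that for
every `L > 0`, every map `g` of class `C²` on the closed cylinder `{r ≤ 1}` with values in a real
inner product space, `L`-periodic in `z` and bounded by `M` on the closed cylinder, and every
direction `v` with `‖v‖ ≤ 1`,
`∫_{{r<1}×(0,L)} ‖Dg v‖⁴ ≤ C M² ∫_{{r<1}×(0,L)} (‖Dg v‖² + ‖D(Dg v)‖²)`. [cite: Ferrari1993, Lemma 1 (ii), p. 280 (the calculus inequality it rests on)] -/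
theorem exists_integral_norm_fderiv_pow_four_le :
    ∃ C : ℝ, 0 ≤ C ∧ ∀ (L : ℝ) (_ : 0 < L) (g : EuclideanSpace ℝ (Fin 3) → F)
      (_ : ContDiffOn ℝ 2 g (closure (unitCylinder : Set (EuclideanSpace ℝ (Fin 3)))))
      (_ : IsAxiallyPeriodic L g) (M : ℝ)
      (_ : ∀ x ∈ closure (unitCylinder : Set (EuclideanSpace ℝ (Fin 3))), ‖g x‖ ≤ M)
      (v : EuclideanSpace ℝ (Fin 3)) (_ : ‖v‖ ≤ 1),
      ∫ x in (cylinderCell L : Set (EuclideanSpace ℝ (Fin 3))), ‖fderiv ℝ g x v‖ ^ 4 ≤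
        C * M ^ 2 * ∫ x in (cylinderCell L : Set (EuclideanSpace ℝ (Fin 3))),
          (‖fderiv ℝ g x v‖ ^ 2 + ‖fderiv ℝ (fun y => fderiv ℝ g y v) x‖ ^ 2) := by
  obtain ⟨Ct, hCt0, hCt⟩ := exists_wallTrace_le (F := F)
  set C₂ : ℝ := 4 * Ct + 3 with hC₂
  refine ⟨2 * C₂ ^ 2, by positivity, fun L hL g hg hper M hM v hv => ?_⟩
  -- geometry
  set K : Set (EuclideanSpace ℝ (Fin 3)) := closure (unitCylinder : Set (EuclideanSpace ℝ (Fin 3)))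
    with hK
  set Ω : Set (EuclideanSpace ℝ (Fin 3)) := (cylinderCell L : Set (EuclideanSpace ℝ (Fin 3))) with hΩ
  have hKu : UniqueDiffOn ℝ K := uniqueDiffOn_closure_unitCylinder
  have hΩm : MeasurableSet Ω := (cylinderCell L).isOpen.measurableSet
  have hΩU : Ω ⊆ (unitCylinder : Set (EuclideanSpace ℝ (Fin 3))) := cylinderCell_le_unitCylinder L
  have hΩK : Ω ⊆ K := hΩU.trans subset_closure
  have hnhds : ∀ x ∈ Ω, K ∈ 𝓝 x := fun x hx => closure_unitCylinder_mem_nhds (hΩU hx)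
  have hM0 : 0 ≤ M := (norm_nonneg _).trans (hM 0 (subset_closure zero_mem_unitCylinder))
  -- the fields `w = ∂ᵥ g`, `W = ‖w‖² w`, `φ = ⟪g, W⟫`, realised up to the boundary
  set w : EuclideanSpace ℝ (Fin 3) → F := fun x => fderivWithin ℝ g K x v with hw_def
  set W : EuclideanSpace ℝ (Fin 3) → F := fun x => ‖w x‖ ^ 2 • w x with hW_def
  set φ : EuclideanSpace ℝ (Fin 3) → ℝ := fun x => ⟪g x, W x⟫ with hφ_def
  have hg1 : ContDiffOn ℝ 1 g K := hg.of_le one_le_two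
  have hw : ContDiffOn ℝ 1 w K := (hg.fderivWithin hKu (by norm_num)).clm_apply contDiffOn_const
  have hW : ContDiffOn ℝ 1 W K := (hw.norm_sq (𝕜 := ℝ)).smul hw
  have hφ : ContDiffOn ℝ 1 φ K := hg1.inner ℝ hW
  -- periodicity
  have hwper : IsAxiallyPeriodic L w := fun x => by
    have h := hper.fderivWithin_closure x
    dsimp only at h
    show (fderivWithin ℝ g (closure (unitCylinder : Set (EuclideanSpace ℝ (Fin 3))))
        (x + L • EuclideanSpace.single 2 1)) v =
      (fderivWithin ℝ g (closure (unitCylinder : Set (EuclideanSpace ℝ (Fin 3)))) x) v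
    rw [h]
  have hWper : IsAxiallyPeriodic L W := fun x => by simp only [hW_def, hwper x]
  have hφper : IsAxiallyPeriodic L φ := fun x => by simp only [hφ_def, hper x, hWper x]
  -- differentiability at the points of the cell
  have hgd : ∀ x ∈ Ω, HasFDerivAt g (fderivWithin ℝ g K x) x := fun x hx =>
    ((hg1.differentiableOn one_ne_zero x (hΩK hx)).differentiableAt (hnhds x hx)).hasFDerivAt.congr_fderiv
      (fderivWithin_of_mem_nhds (hnhds x hx)).symm
  have hwx : ∀ x ∈ Ω, fderiv ℝ g x v = w x := fun x hx => by
    simp only [hw_def, (hgd x hx).fderiv]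
  have hwd : ∀ x ∈ Ω, DifferentiableAt ℝ w x := fun x hx =>
    (hw.differentiableOn one_ne_zero x (hΩK hx)).differentiableAt (hnhds x hx)
  have hWd : ∀ x ∈ Ω, DifferentiableAt ℝ W x := fun x hx =>
    (hW.differentiableOn one_ne_zero x (hΩK hx)).differentiableAt (hnhds x hx)
  have hgd' : ∀ x ∈ Ω, DifferentiableAt ℝ g x := fun x hx => (hgd x hx).differentiableAt
  have hwK : ∀ x ∈ Ω, fderiv ℝ w x = fderivWithin ℝ w K x := fun x hx =>
    (fderivWithin_of_mem_nhds (hnhds x hx)).symm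
  have hWK : ∀ x ∈ Ω, fderiv ℝ W x = fderivWithin ℝ W K x := fun x hx =>
    (fderivWithin_of_mem_nhds (hnhds x hx)).symm
  have hφK : ∀ x ∈ Ω, fderiv ℝ φ x = fderivWithin ℝ φ K x := fun x hx =>
    (fderivWithin_of_mem_nhds (hnhds x hx)).symm
  -- `D(∂ᵥ g) = Dw` on the cell
  have hDw : ∀ x ∈ Ω, fderiv ℝ (fun y => fderiv ℝ g y v) x = fderiv ℝ w x := fun x hx => by
    refine Filter.EventuallyEq.fderiv_eq ?_
    filter_upwards [unitCylinder.isOpen.mem_nhds (hΩU hx)] with y hy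
    simp only [hw_def]
    rw [fderivWithin_of_mem_nhds (closure_unitCylinder_mem_nhds hy)]
  -- the two pointwise facts
  have hDWle : ∀ x ∈ Ω, ‖fderiv ℝ W x‖ ≤ 3 * ‖w x‖ ^ 2 * ‖fderiv ℝ w x‖ := fun x hx =>
    norm_fderiv_norm_sq_smul_le (hwd x hx)
  have hkey : ∀ x ∈ Ω, ‖w x‖ ^ 4 = fderiv ℝ φ x v - ⟪g x, fderiv ℝ W x v⟫ := fun x hx => by
    have h := fderiv_inner_apply (𝕜 := ℝ) (hgd' x hx) (hWd x hx) v
    rw [show (fun t => ⟪g t, W t⟫) = φ from rfl] at h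
    rw [h, hwx x hx, hW_def]
    simp only [real_inner_smul_right, real_inner_self_eq_norm_sq]
    ring
  -- continuity up to the boundary of the integrands (for integrability on the cell)
  have cw : ContinuousOn w K := hw.continuousOn
  have cW : ContinuousOn W K := hW.continuousOn
  have cg : ContinuousOn g K := hg.continuousOn
  have cDw : ContinuousOn (fun x => fderivWithin ℝ w K x) K := hw.continuousOn_fderivWithin hKu le_rfl
  have cDW : ContinuousOn (fun x => fderivWithin ℝ W K x) K := hW.continuousOn_fderivWithin hKu le_rfl
  have cDφ : ContinuousOn (fun x => fderivWithin ℝ φ K x) K := hφ.continuousOn_fderivWithin hKu le_rfl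
  have int : ∀ {f : EuclideanSpace ℝ (Fin 3) → ℝ}, ContinuousOn f K → IntegrableOn f Ω volume :=
    fun hf => integrableOn_cylinderCell_of_continuousOn_closure L hf
  -- the basic integrals
  set I4 : ℝ := ∫ x in Ω, ‖w x‖ ^ 4 with hI4
  set I2 : ℝ := ∫ x in Ω, ‖w x‖ ^ 2 with hI2
  set J2 : ℝ := ∫ x in Ω, ‖fderivWithin ℝ w K x‖ ^ 2 with hJ2
  set I3 : ℝ := ∫ x in Ω, ‖w x‖ ^ 2 * ‖w x‖ with hI3
  set IJ : ℝ := ∫ x in Ω, ‖w x‖ ^ 2 * ‖fderivWithin ℝ w K x‖ with hIJ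
  have hI4_0 : 0 ≤ I4 := setIntegral_nonneg hΩm fun x _ => by positivity
  have hI2_0 : 0 ≤ I2 := setIntegral_nonneg hΩm fun x _ => by positivity
  have hJ2_0 : 0 ≤ J2 := setIntegral_nonneg hΩm fun x _ => by positivity
  have hI3_0 : 0 ≤ I3 := setIntegral_nonneg hΩm fun x _ => by positivity
  have hIJ_0 : 0 ≤ IJ := setIntegral_nonneg hΩm fun x _ => by positivity
  -- integrability of everything in sight
  have iφ : IntegrableOn (fun x => fderivWithin ℝ φ K x v) Ω volume :=
    int (cDφ.clm_apply continuousOn_const)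
  have iG : IntegrableOn (fun x => ⟪g x, fderivWithin ℝ W K x v⟫) Ω volume :=
    int (cg.inner (cDW.clm_apply continuousOn_const))
  have i3 : IntegrableOn (fun x => ‖w x‖ ^ 2 * ‖w x‖) Ω volume := int ((cw.norm.pow 2).mul cw.norm)
  have iJ : IntegrableOn (fun x => ‖w x‖ ^ 2 * ‖fderivWithin ℝ w K x‖) Ω volume :=
    int ((cw.norm.pow 2).mul cDw.norm)
  have i2 : IntegrableOn (fun x => ‖w x‖ ^ 2) Ω volume := int (cw.norm.pow 2)
  have iJ2 : IntegrableOn (fun x => ‖fderivWithin ℝ w K x‖ ^ 2) Ω volume := int (cDw.norm.pow 2)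
  -- Step A: `I4 = ∫ ∂ᵥφ - ∫ ⟪g, ∂ᵥW⟫`
  set T1 : ℝ := ∫ x in Ω, fderivWithin ℝ φ K x v with hT1
  set T2 : ℝ := ∫ x in Ω, ⟪g x, fderivWithin ℝ W K x v⟫ with hT2
  have hA : I4 = T1 - T2 := by
    rw [hT1, hT2, ← integral_sub iφ iG, hI4]
    exact setIntegral_congr_fun hΩm fun x hx => by
      simp only [hkey x hx, hφK x hx, hWK x hx]
  -- Step B: the wall term
  have hB : |T1| ≤ M * Ct * (I3 + 3 * IJ) := by
    -- to the wall
    have e1 : T1 = ∫ x in Ω, fderiv ℝ φ x v := by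
      rw [hT1]; exact setIntegral_congr_fun hΩm fun x hx => by rw [hφK x hx]
    have e2 := setIntegral_fderiv_apply_cylinderCell_eq_wallFlux hL.le hφ hφper v
    rw [← hΩ] at e2
    rw [e2] at e1
    -- on the wall, `|φ ⟪v, e_r⟫| ≤ M ‖W‖`
    have hwc : IsCompact (cylWall L) := by rw [cylWall_eq]; exact isCompact_Icc
    have hwm : MeasurableSet (cylWall L) := by rw [cylWall_eq]; exact measurableSet_Icc
    have hmaps : ∀ y ∈ cylWall L, cylCoord (Fin.insertNth 0 (1 : ℝ) y) ∈ K := fun y _ => by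
      refine cylCoord_mem_closure ?_ ?_ <;> simp
    have hcont : Continuous fun y : Fin 2 → ℝ => cylCoord (Fin.insertNth 0 (1 : ℝ) y) := by
      simp_rw [cylCoord_insertNth_zero_one]
      exact (contDiff_frameR.continuous.comp (continuous_apply 0)).add
        ((continuous_apply 1).smul continuous_const)
    have hframe : ∀ θ : ℝ, ‖frameR θ‖ = 1 := fun θ => by
      rw [← frameBasis_apply_zero θ]
      exact (frameBasis θ).orthonormal.norm_eq_one 0
    have hφw : ContinuousOn
        (fun y : Fin 2 → ℝ => φ (cylCoord (Fin.insertNth 0 (1 : ℝ) y)) * ⟪v, frameR (y 0)⟫)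
        (cylWall L) :=
      (hφ.continuousOn.comp hcont.continuousOn hmaps).mul
        (continuousOn_const.inner
          (contDiff_frameR.continuous.comp (continuous_apply 0)).continuousOn)
    have hWw : ContinuousOn (fun y : Fin 2 → ℝ => M * ‖W (cylCoord (Fin.insertNth 0 (1 : ℝ) y))‖)
        (cylWall L) := continuousOn_const.mul (cW.comp hcont.continuousOn hmaps).norm
    have hwall : |∫ y in cylWall L, φ (cylCoord (Fin.insertNth 0 (1 : ℝ) y)) * ⟪v, frameR (y 0)⟫| ≤
        ∫ y in cylWall L, M * ‖W (cylCoord (Fin.insertNth 0 (1 : ℝ) y))‖ := by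
      refine (abs_integral_le_integral_abs).trans ?_
      refine setIntegral_mono_on (hφw.integrableOn_compact hwc).abs (hWw.integrableOn_compact hwc)
        hwm fun y hy => ?_
      set q := cylCoord (Fin.insertNth 0 (1 : ℝ) y) with hq
      have h1 : |⟪v, frameR (y 0)⟫| ≤ 1 :=
        (abs_real_inner_le_norm _ _).trans (by rw [hframe, mul_one]; exact hv)
      have h2 : |φ q| ≤ M * ‖W q‖ :=
        (abs_real_inner_le_norm _ _).trans (mul_le_mul_of_nonneg_right (hM q (hmaps y hy)) (norm_nonneg _))
      show |φ q * ⟪v, frameR (y 0)⟫| ≤ M * ‖W q‖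
      rw [abs_mul]
      calc |φ q| * |⟪v, frameR (y 0)⟫| ≤ M * ‖W q‖ * 1 :=
            mul_le_mul h2 h1 (abs_nonneg _) (by positivity)
        _ = M * ‖W q‖ := mul_one _
    -- the trace inequality and the pointwise bounds in the cell
    have htr := hCt L hL.le W hW
    have hcell : ∫ x in Ω, (‖W x‖ + ‖fderiv ℝ W x‖) ≤ I3 + 3 * IJ := by
      have iL : IntegrableOn (fun x => ‖W x‖ + ‖fderiv ℝ W x‖) Ω volume :=
        (int (cW.norm.add cDW.norm)).congr_fun (fun x hx => by
          simp only [Pi.add_apply, hWK x hx]) hΩm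
      rw [hI3, hIJ, ← integral_const_mul, ← integral_add i3 (iJ.const_mul 3)]
      refine setIntegral_mono_on iL (i3.add (iJ.const_mul 3)) hΩm fun x hx => ?_
      have hn : ‖W x‖ = ‖w x‖ ^ 2 * ‖w x‖ := by
        simp only [hW_def, norm_smul, Real.norm_of_nonneg (sq_nonneg _)]
      have hd : ‖fderiv ℝ W x‖ ≤ 3 * (‖w x‖ ^ 2 * ‖fderivWithin ℝ w K x‖) := by
        rw [← hwK x hx, ← mul_assoc]; exact hDWle x hx
      linarith
    calc |T1| = |∫ y in cylWall L, φ (cylCoord (Fin.insertNth 0 (1 : ℝ) y)) * ⟪v, frameR (y 0)⟫| := by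
          rw [e1]
      _ ≤ ∫ y in cylWall L, M * ‖W (cylCoord (Fin.insertNth 0 (1 : ℝ) y))‖ := hwall
      _ = M * ∫ y in cylWall L, ‖W (cylCoord (Fin.insertNth 0 (1 : ℝ) y))‖ := integral_const_mul _ _
      _ ≤ M * (Ct * ∫ x in Ω, (‖W x‖ + ‖fderiv ℝ W x‖)) := mul_le_mul_of_nonneg_left htr hM0
      _ ≤ M * (Ct * (I3 + 3 * IJ)) := by gcongr
      _ = M * Ct * (I3 + 3 * IJ) := by ring
  -- Step C: the interior term
  have hC : |T2| ≤ 3 * M * IJ := by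
    have iR : IntegrableOn (fun x => M * (3 * (‖w x‖ ^ 2 * ‖fderivWithin ℝ w K x‖))) Ω volume :=
      (iJ.const_mul 3).const_mul M
    calc |T2| ≤ ∫ x in Ω, |⟪g x, fderivWithin ℝ W K x v⟫| := abs_integral_le_integral_abs
      _ ≤ ∫ x in Ω, M * (3 * (‖w x‖ ^ 2 * ‖fderivWithin ℝ w K x‖)) := by
          refine setIntegral_mono_on iG.abs iR hΩm fun x hx => ?_
          calc |⟪g x, fderivWithin ℝ W K x v⟫| ≤ ‖g x‖ * ‖fderivWithin ℝ W K x v‖ :=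
                abs_real_inner_le_norm _ _
            _ ≤ M * (‖fderivWithin ℝ W K x‖ * ‖v‖) :=
                mul_le_mul (hM x (hΩK hx)) (ContinuousLinearMap.le_opNorm _ _) (norm_nonneg _) hM0
            _ ≤ M * (‖fderivWithin ℝ W K x‖ * 1) := by gcongr
            _ ≤ M * (3 * (‖w x‖ ^ 2 * ‖fderivWithin ℝ w K x‖)) := by
                rw [mul_one, ← hWK x hx, ← hwK x hx, ← mul_assoc 3]
                exact mul_le_mul_of_nonneg_left (hDWle x hx) hM0
      _ = 3 * M * IJ := by rw [integral_const_mul, integral_const_mul, hIJ]; ring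
  -- Step D
  have hD : I4 ≤ M * C₂ * (I3 + IJ) := by
    have h1 : I4 ≤ |T1| + |T2| := by
      rw [hA]
      have := le_abs_self T1
      have := neg_abs_le T2
      linarith
    have h2 : M * Ct * (I3 + 3 * IJ) + 3 * M * IJ ≤ M * C₂ * (I3 + IJ) := by
      rw [hC₂]
      have := mul_nonneg hM0 hCt0
      nlinarith [mul_nonneg hM0 hI3_0, mul_nonneg hM0 hIJ_0, mul_nonneg this hI3_0,
        mul_nonneg this hIJ_0]
    linarith [hB, hC]
  -- Step E: Cauchy–Schwarz
  have hE3 : I3 ≤ Real.sqrt I4 * Real.sqrt I2 :=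
    setIntegral_sq_mul_le_sqrt_mul_sqrt L cw.norm cw.norm fun x => norm_nonneg _
  have hEJ : IJ ≤ Real.sqrt I4 * Real.sqrt J2 :=
    setIntegral_sq_mul_le_sqrt_mul_sqrt L cw.norm cDw.norm fun x => norm_nonneg _
  -- Step F: the quadratic inequality
  set S := Real.sqrt I4 with hS
  set A := Real.sqrt I2 with hA_def
  set B := Real.sqrt J2 with hB_def
  have hS0 : 0 ≤ S := Real.sqrt_nonneg _
  have hA0 : 0 ≤ A := Real.sqrt_nonneg _
  have hB0 : 0 ≤ B := Real.sqrt_nonneg _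
  have hSS : S ^ 2 = I4 := Real.sq_sqrt hI4_0
  have hAA : A ^ 2 = I2 := Real.sq_sqrt hI2_0
  have hBB : B ^ 2 = J2 := Real.sq_sqrt hJ2_0
  have hC₂0 : 0 ≤ C₂ := by positivity
  have hquad : I4 ≤ 2 * C₂ ^ 2 * M ^ 2 * (I2 + J2) := by
    have hMC : 0 ≤ M * C₂ := mul_nonneg hM0 hC₂0
    have h1 : I4 ≤ M * C₂ * (A + B) * S :=
      calc I4 ≤ M * C₂ * (I3 + IJ) := hD
        _ ≤ M * C₂ * (S * A + S * B) := mul_le_mul_of_nonneg_left (add_le_add hE3 hEJ) hMC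
        _ = M * C₂ * (A + B) * S := by ring
    have hab : (A + B) ^ 2 ≤ 2 * (A ^ 2 + B ^ 2) := by
      have e : (A + B) ^ 2 + (A - B) ^ 2 = 2 * (A ^ 2 + B ^ 2) := by ring
      linarith [sq_nonneg (A - B)]
    rcases hS0.lt_or_eq with hSpos | hS0'
    · have h1' : S * S ≤ M * C₂ * (A + B) * S := by rw [← sq, hSS]; exact h1
      have h2 : S ≤ M * C₂ * (A + B) := le_of_mul_le_mul_right h1' hSpos
      have h3 : I4 ≤ (M * C₂ * (A + B)) ^ 2 := by
        rw [← hSS]; exact pow_le_pow_left₀ hS0 h2 2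
      have h4 : (M * C₂ * (A + B)) ^ 2 = C₂ ^ 2 * M ^ 2 * (A + B) ^ 2 := by ring
      have h5 : C₂ ^ 2 * M ^ 2 * (A + B) ^ 2 ≤ C₂ ^ 2 * M ^ 2 * (2 * (A ^ 2 + B ^ 2)) :=
        mul_le_mul_of_nonneg_left hab (by positivity)
      have h6 : C₂ ^ 2 * M ^ 2 * (2 * (A ^ 2 + B ^ 2)) = 2 * C₂ ^ 2 * M ^ 2 * (I2 + J2) := by
        rw [hAA, hBB]; ring
      linarith
    · have hI40 : I4 = 0 := by
        have h := hSS
        rw [← hS0'] at h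
        norm_num at h
        exact h.symm
      rw [hI40]
      positivity
  -- back to the statement
  have eL : ∫ x in Ω, ‖fderiv ℝ g x v‖ ^ 4 = I4 := by
    rw [hI4]; exact setIntegral_congr_fun hΩm fun x hx => by rw [hwx x hx]
  have eR : ∫ x in Ω, (‖fderiv ℝ g x v‖ ^ 2 + ‖fderiv ℝ (fun y => fderiv ℝ g y v) x‖ ^ 2) = I2 + J2 := by
    rw [hI2, hJ2, ← integral_add i2 iJ2]
    exact setIntegral_congr_fun hΩm fun x hx => by rw [hwx x hx, hDw x hx, hwK x hx]
  rw [eL, eR]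
  exact hquad

/-- **The `L⁴` inequality for an arbitrary direction**: with the homogeneity `∂_{cv} = c ∂ᵥ`,
`∫_cell ‖Dg v‖⁴ ≤ C M² ‖v‖² ∫_cell (‖Dg v‖² + ‖D(Dg v)‖²)` for every `v` (same constant).
[cite: Ferrari1993, Lemma 1 (ii), p. 280 (the calculus inequality it rests on)] -/
theorem exists_integral_norm_fderiv_pow_four_le' :
    ∃ C : ℝ, 0 ≤ C ∧ ∀ (L : ℝ) (_ : 0 < L) (g : EuclideanSpace ℝ (Fin 3) → F)
      (_ : ContDiffOn ℝ 2 g (closure (unitCylinder : Set (EuclideanSpace ℝ (Fin 3)))))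
      (_ : IsAxiallyPeriodic L g) (M : ℝ)
      (_ : ∀ x ∈ closure (unitCylinder : Set (EuclideanSpace ℝ (Fin 3))), ‖g x‖ ≤ M)
      (v : EuclideanSpace ℝ (Fin 3)),
      ∫ x in (cylinderCell L : Set (EuclideanSpace ℝ (Fin 3))), ‖fderiv ℝ g x v‖ ^ 4 ≤
        C * M ^ 2 * ‖v‖ ^ 2 * ∫ x in (cylinderCell L : Set (EuclideanSpace ℝ (Fin 3))),
          (‖fderiv ℝ g x v‖ ^ 2 + ‖fderiv ℝ (fun y => fderiv ℝ g y v) x‖ ^ 2) := by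
  obtain ⟨C, hC0, hC⟩ := exists_integral_norm_fderiv_pow_four_le (F := F)
  refine ⟨C, hC0, fun L hL g hg hper M hM v => ?_⟩
  rcases eq_or_ne v 0 with rfl | hv
  · simp
  set c : ℝ := ‖v‖ with hc
  have hcpos : 0 < c := norm_pos_iff.2 hv
  set e : EuclideanSpace ℝ (Fin 3) := c⁻¹ • v with he
  have hev : v = c • e := by rw [he, smul_smul, mul_inv_cancel₀ hcpos.ne', one_smul]
  have henorm : ‖e‖ ≤ 1 := by
    rw [he, norm_smul, norm_inv, norm_norm, inv_mul_cancel₀ hcpos.ne']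
  have h := hC L hL g hg hper M hM e henorm
  -- homogeneity of the two derivatives in the direction
  have h1 : ∀ x, fderiv ℝ g x v = c • fderiv ℝ g x e := fun x => by
    rw [hev, map_smul]
  have h2 : ∀ x, fderiv ℝ (fun y => fderiv ℝ g y v) x = c • fderiv ℝ (fun y => fderiv ℝ g y e) x := by
    intro x
    have e1 : (fun y => fderiv ℝ g y v) = c • fun y => fderiv ℝ g y e := funext fun y => by
      simp only [h1 y, Pi.smul_apply]
    haveI : Invertible c := invertibleOfNonzero hcpos.ne'
    rw [e1, fderiv_const_smul_of_invertible]
  -- scale the integrals (assumed `c > 0`)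
  have eL : ∫ x in (cylinderCell L : Set (EuclideanSpace ℝ (Fin 3))), ‖fderiv ℝ g x v‖ ^ 4 =
      c ^ 4 * ∫ x in (cylinderCell L : Set (EuclideanSpace ℝ (Fin 3))), ‖fderiv ℝ g x e‖ ^ 4 := by
    rw [← integral_const_mul]
    refine integral_congr_ae (Eventually.of_forall fun x => ?_)
    simp only [h1 x, norm_smul, Real.norm_of_nonneg hcpos.le]
    ring
  have eR : ∫ x in (cylinderCell L : Set (EuclideanSpace ℝ (Fin 3))),
      (‖fderiv ℝ g x v‖ ^ 2 + ‖fderiv ℝ (fun y => fderiv ℝ g y v) x‖ ^ 2) =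
      c ^ 2 * ∫ x in (cylinderCell L : Set (EuclideanSpace ℝ (Fin 3))),
        (‖fderiv ℝ g x e‖ ^ 2 + ‖fderiv ℝ (fun y => fderiv ℝ g y e) x‖ ^ 2) := by
    rw [← integral_const_mul]
    refine integral_congr_ae (Eventually.of_forall fun x => ?_)
    simp only [h1 x, h2 x, norm_smul, Real.norm_of_nonneg hcpos.le]
    ring
  rw [eL, eR]
  have hI : 0 ≤ ∫ x in (cylinderCell L : Set (EuclideanSpace ℝ (Fin 3))), ‖fderiv ℝ g x e‖ ^ 4 :=
    setIntegral_nonneg (cylinderCell L).isOpen.measurableSet fun x _ => by positivity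
  have hc1 : c ^ 4 ≤ c ^ 2 * 1 * c ^ 2 := by nlinarith [sq_nonneg c]
  calc c ^ 4 * ∫ x in (cylinderCell L : Set (EuclideanSpace ℝ (Fin 3))), ‖fderiv ℝ g x e‖ ^ 4
      ≤ c ^ 4 * (C * M ^ 2 * ∫ x in (cylinderCell L : Set (EuclideanSpace ℝ (Fin 3))),
          (‖fderiv ℝ g x e‖ ^ 2 + ‖fderiv ℝ (fun y => fderiv ℝ g y e) x‖ ^ 2)) :=
        mul_le_mul_of_nonneg_left h (by positivity)
    _ = C * M ^ 2 * c ^ 2 * (c ^ 2 * ∫ x in (cylinderCell L : Set (EuclideanSpace ℝ (Fin 3))),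
          (‖fderiv ℝ g x e‖ ^ 2 + ‖fderiv ℝ (fun y => fderiv ℝ g y e) x‖ ^ 2)) := by ring


end GN

end Literature.Analysis.FluidPDE
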